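import Mathlib
import Literature.Analysis.FluidPDE.SelfSimilarEulerProfile
import Literature.Analysis.FluidPDE.SelfSimilarEulerOutgoingExclusionTools
import Summits.NavierStokesRegularity.NavierStokesRegularity.Theorems.EulerZoomLiouvillePowerGaugeEulerLiouvilleSelfSimilarBackwardEscape
import HarnessLib

/-!
# «ANY FAST CHANNEL KILLS», tools: Bernoulli monotonicity along backward arcs, first hitting times, and the no-return escape bootstrap
# (crux `EulerZoomLiouville.PowerGaugeEulerLiouville` = stmt-NavierStokesRegularity-19832, THE ONE STATEMENT `stub_selfSimilarC2Needle`, binder `HasFastVorticalChannel`)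

Route `EulerZoomLiouville` (NavierStokesRegularity), crux E, LEAD seat ns-typeII-p2 g13 (own brick).  Class-free ODE tools for the sequel
`…ChannelClock` (`ChannelClock.logClock_of_channel`: a one-sided vortical Bernoulli channel at ANY rate `c₁ > 0` is a log residence clock).
Let `(V, P′)` be a classical self-similar Euler profile about `0` at rate `γ` (CIV (3.3)), `W y = γy + V y`, `ℋ` its Bernoulli function.

* `ChannelClock.bernoulli_le_of_arc` — `ℋ(Y 0) ≤ ℋ(Y σ₁)` along a `C¹` backward arc `Y′ = −W(Y)` on `[0, σ₁]` when `γ ≤ ½` ((3.31):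
  `(ℋ∘Y)′ = (1−2γ)‖W(Y)‖² ≥ 0`).
* `ChannelClock.exists_first_hit` — first hitting time of a level `L` by a function continuous on `[0, σ₀]` with `f 0 < L ≤ f σ₀`:
  some `σ₁ ∈ (0, σ₀]` with `f σ₁ = L` and `f ≤ L` on `[0, σ₁]` (infimum of a closed set + closedness from the left).
* `ChannelClock.norm_ge_of_channel_arc` — THE NO-RETURN ESCAPE BOOTSTRAP: along a backward arc on `[0, S]` that is Bernoulli-high (`ℋ > h`) and
  vortical throughout and starts at radius `‖Z 0‖ ≥ 2R₁`, a one-sided channel beyond `R₁` (`⟪y, W y⟫ ≤ −c₁‖y‖²` at vortical points of `{ℋ > h}`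
  with `‖y‖ ≥ R₁`) keeps the arc beyond `R₁` and gives `‖Z s‖ ≥ ‖Z 0‖e^{c₁ s}` (Grönwall `BackwardEscape.norm_ge_mul_exp_of_fastInflow` on every
  initial segment beyond `R₁`; the first return time below `R₁` would be preceded by radius `≥ 2R₁` — contradiction by continuity).

WHAT THIS IS NOT: not NS, not E — class-free calculus/ODE lemmas (no budgets), `--supports` stmt-19832; the crux is OPEN; NS regularity is NOT
proved. [folklore; cf. ConstantinIgnatovaVicol2026Putative §3.4 (3.19)–(3.20), §3.4.3 (3.31)]
-/

noncomputable section

-- flat `Theorems/<Route><Decl>…` files of one crux share the namespace of the crux (tree convention: `Summit.<S>.<S>.…`)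
set_option linter.dupNamespace false

open Set Filter Topology Metric MeasureTheory
open scoped RealInnerProductSpace ENNReal

namespace Summit.NavierStokesRegularity.NavierStokesRegularity.Theorems.PowerGaugeEulerLiouville

open Literature.Analysis Literature.Analysis.FluidPDE

namespace ChannelClock

variable {γ : ℝ} {V : EuclideanSpace ℝ (Fin 3) → EuclideanSpace ℝ (Fin 3)} {P' : EuclideanSpace ℝ (Fin 3) → ℝ}

/-- **`ℋ` is non-decreasing along backward arcs** ((3.31) with `γ ≤ ½`): if `Y′ = −W(Y)` on `[0, σ₁]` then `ℋ(Y 0) ≤ ℋ(Y σ₁)`.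
[cite: ConstantinIgnatovaVicol2026Putative, §3.4.3 eq. (3.31)] -/
theorem bernoulli_le_of_arc (hprof : IsSelfSimilarEulerProfile γ 0 V P') (hγ2 : γ ≤ 1 / 2)
    {Y : ℝ → EuclideanSpace ℝ (Fin 3)} {σ₁ : ℝ} (hσ₁ : 0 ≤ σ₁)
    (hY : ∀ σ ∈ Icc 0 σ₁, HasDerivAt Y (-(selfSimilarTransport γ 0 V (Y σ))) σ) :
    selfSimilarBernoulli γ 0 V P' (Y 0) ≤ selfSimilarBernoulli γ 0 V P' (Y σ₁) := by
  have hH1 : ContDiff ℝ 1 (selfSimilarBernoulli γ 0 V P') := hprof.contDiff_selfSimilarBernoulli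
  set g : ℝ → ℝ := fun s => selfSimilarBernoulli γ 0 V P' (Y s) with hgdef
  have hderiv : ∀ σ ∈ Icc 0 σ₁, HasDerivAt g ((1 - 2 * γ) * ‖selfSimilarTransport γ 0 V (Y σ)‖ ^ 2) σ := by
    intro σ hσ
    have hHd : HasFDerivAt (selfSimilarBernoulli γ 0 V P') (fderiv ℝ (selfSimilarBernoulli γ 0 V P') (Y σ)) (Y σ) :=
      ((hH1.differentiable one_ne_zero) (Y σ)).hasFDerivAt
    have hcomp := hHd.comp_hasDerivAt σ (hY σ hσ)
    have e : fderiv ℝ (selfSimilarBernoulli γ 0 V P') (Y σ) (-(selfSimilarTransport γ 0 V (Y σ))) =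
        (1 - 2 * γ) * ‖selfSimilarTransport γ 0 V (Y σ)‖ ^ 2 := by
      rw [map_neg, hprof.fderiv_selfSimilarBernoulli_transport (Y σ)]; ring
    rw [e] at hcomp
    exact hcomp
  have hmono : MonotoneOn g (Icc 0 σ₁) := by
    have hcont : ContinuousOn g (Icc 0 σ₁) := fun s hs => (hderiv s hs).continuousAt.continuousWithinAt
    have hdiff : DifferentiableOn ℝ g (interior (Icc 0 σ₁)) := by
      rw [interior_Icc]
      exact fun s hs => (hderiv s (Ioo_subset_Icc_self hs)).differentiableAt.differentiableWithinAt
    refine monotoneOn_of_deriv_nonneg (convex_Icc 0 σ₁) hcont hdiff fun s hs => ?_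
    rw [interior_Icc] at hs
    rw [(hderiv s (Ioo_subset_Icc_self hs)).deriv]
    exact mul_nonneg (by linarith) (sq_nonneg _)
  exact hmono (left_mem_Icc.2 hσ₁) (right_mem_Icc.2 hσ₁) hσ₁

/-- **First hitting time of a level** (elementary): if `f` is continuous on `[0, σ₀]`, `f 0 < L ≤ f σ₀`, then there is `σ₁ ∈ (0, σ₀]` with
`f σ₁ = L` and `f ≤ L` on `[0, σ₁]`. [folklore] -/
theorem exists_first_hit {f : ℝ → ℝ} {σ₀ L : ℝ} (hσ₀ : 0 ≤ σ₀) (hf : ContinuousOn f (Icc 0 σ₀))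
    (h0 : f 0 < L) (h1 : L ≤ f σ₀) :
    ∃ σ₁ : ℝ, 0 < σ₁ ∧ σ₁ ≤ σ₀ ∧ f σ₁ = L ∧ ∀ σ ∈ Icc 0 σ₁, f σ ≤ L := by
  set A : Set ℝ := {σ | σ ∈ Icc 0 σ₀ ∧ L ≤ f σ} with hAdef
  have hAclosed : IsClosed A := by
    have := hf.preimage_isClosed_of_isClosed isClosed_Icc (isClosed_Ici (a := L))
    rw [hAdef]
    convert this using 1
    ext σ; simp [Set.mem_preimage, and_comm]
  have hAne : A.Nonempty := ⟨σ₀, right_mem_Icc.2 hσ₀, h1⟩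
  have hAbdd : BddBelow A := ⟨0, fun σ hσ => hσ.1.1⟩
  set σ₁ := sInf A with hσ₁def
  have hσ₁A : σ₁ ∈ A := hAclosed.csInf_mem hAne hAbdd
  have hlt : ∀ σ, 0 ≤ σ → σ < σ₁ → f σ < L := by
    intro σ hσ0 hσ
    by_contra hge
    have hσA : σ ∈ A := ⟨⟨hσ0, le_trans hσ.le hσ₁A.1.2⟩, le_of_not_gt hge⟩
    exact absurd (csInf_le hAbdd hσA) (not_le.2 hσ)
  have hσ₁pos : 0 < σ₁ := by
    rcases hσ₁A.1.1.lt_or_eq with h | h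
    · exact h
    · exfalso; rw [← h] at hσ₁A; exact absurd hσ₁A.2 (not_le.2 h0)
  -- `f σ₁ ≤ L` by closedness from the left
  have hle : f σ₁ ≤ L := by
    have hsub : Ico 0 σ₁ ⊆ {σ | σ ∈ Icc 0 σ₀ ∧ f σ ≤ L} := fun σ hσ =>
      ⟨⟨hσ.1, le_trans hσ.2.le hσ₁A.1.2⟩, (hlt σ hσ.1 hσ.2).le⟩
    have hBclosed : IsClosed {σ | σ ∈ Icc 0 σ₀ ∧ f σ ≤ L} := by
      have := hf.preimage_isClosed_of_isClosed isClosed_Icc (isClosed_Iic (a := L))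
      convert this using 1
      ext σ; simp [Set.mem_preimage, and_comm, and_left_comm]
    have hcl : closure (Ico 0 σ₁) ⊆ {σ | σ ∈ Icc 0 σ₀ ∧ f σ ≤ L} := hBclosed.closure_subset_iff.2 hsub
    have hmem : σ₁ ∈ closure (Ico (0 : ℝ) σ₁) := by
      rw [closure_Ico hσ₁pos.ne]; exact right_mem_Icc.2 hσ₁pos.le
    exact (hcl hmem).2
  refine ⟨σ₁, hσ₁pos, hσ₁A.1.2, le_antisymm hle hσ₁A.2, fun σ hσ => ?_⟩
  rcases hσ.2.lt_or_eq with h | h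
  · exact (hlt σ hσ.1 h).le
  · rw [h]; exact hle

/-- **The no-return escape bootstrap**: along a backward arc `Z′ = −W(Z)` on `[0, S]` that is Bernoulli-high and vortical throughout, starting at
radius `‖Z 0‖ ≥ 2R₁ > 0`, a one-sided channel beyond `R₁` at rate `c₁ > 0` keeps the arc beyond `R₁` and gives `‖Z s‖ ≥ ‖Z 0‖·e^{c₁ s}` on `[0, S]`.
[folklore; cf. ConstantinIgnatovaVicol2026Putative §3.4 (3.19)–(3.20)] -/
theorem norm_ge_of_channel_arc {c₁ R₁ h S : ℝ} (hc₁ : 0 < c₁) (hR₁ : 0 < R₁) (hS : 0 ≤ S)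
    (hfar : ∀ y : EuclideanSpace ℝ (Fin 3), R₁ ≤ ‖y‖ → h < selfSimilarBernoulli γ 0 V P' y → curl V y ≠ 0 →
      ⟪y, selfSimilarTransport γ 0 V y⟫ ≤ -(c₁ * ‖y‖ ^ 2))
    {Z : ℝ → EuclideanSpace ℝ (Fin 3)}
    (hZ : ∀ s ∈ Icc 0 S, HasDerivAt Z (-(selfSimilarTransport γ 0 V (Z s))) s)
    (hhigh : ∀ s ∈ Icc 0 S, h < selfSimilarBernoulli γ 0 V P' (Z s))
    (hvort : ∀ s ∈ Icc 0 S, curl V (Z s) ≠ 0)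
    (hZ0 : 2 * R₁ ≤ ‖Z 0‖) :
    ∀ s ∈ Icc 0 S, ‖Z 0‖ * Real.exp (c₁ * s) ≤ ‖Z s‖ := by
  have hZcont : ContinuousOn Z (Icc 0 S) := fun s hs => (hZ s hs).continuousAt.continuousWithinAt
  have hnc : ContinuousOn (fun s => ‖Z s‖) (Icc 0 S) := hZcont.norm
  have hZ' : ∀ s ∈ Icc 0 S, HasDerivAt Z ((-1 : ℝ) • selfSimilarTransport γ 0 V (Z s)) s := by
    intro s hs; rw [neg_one_smul]; exact hZ s hs
  -- Grönwall on any initial segment that stays beyond `R₁`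
  have hgron : ∀ s₂ ∈ Icc 0 S, (∀ s ∈ Icc 0 s₂, R₁ ≤ ‖Z s‖) →
      ∀ s ∈ Icc 0 s₂, ‖Z 0‖ * Real.exp (c₁ * s) ≤ ‖Z s‖ := by
    intro s₂ hs₂ hfar₂ s hs
    have hsub : Icc 0 s₂ ⊆ Icc 0 S := Icc_subset_Icc_right hs₂.2
    have h := BackwardEscape.norm_ge_mul_exp_of_fastInflow (γ := γ) (V := V) (Y := Z) (c₁ := c₁) hs₂.1
      (fun t ht => hZ' t (hsub ht))
      (fun t ht => hfar (Z t) (hfar₂ t ht) (hhigh t (hsub ht)) (hvort t (hsub ht))) s hs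
    simpa using h
  -- the arc never returns below `R₁`
  have hfarall : ∀ s ∈ Icc 0 S, R₁ ≤ ‖Z s‖ := by
    by_contra hnot
    push Not at hnot
    obtain ⟨sb, hsb, hsbR⟩ := hnot
    set B : Set ℝ := {s | s ∈ Icc 0 S ∧ ‖Z s‖ < R₁} with hBdef
    have hBne : B.Nonempty := ⟨sb, hsb, hsbR⟩
    have hBbdd : BddBelow B := ⟨0, fun s hs => hs.1.1⟩
    set s₂ := sInf B with hs₂def
    have hs₂0 : 0 ≤ s₂ := le_csInf hBne fun s hs => hs.1.1
    have hs₂S : s₂ ≤ S := le_trans (csInf_le hBbdd ⟨hsb, hsbR⟩) hsb.2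
    have hbefore : ∀ s, 0 ≤ s → s < s₂ → R₁ ≤ ‖Z s‖ := by
      intro s hs0 hs
      by_contra hlt
      have hsB : s ∈ B := ⟨⟨hs0, le_trans hs.le hs₂S⟩, lt_of_not_ge hlt⟩
      exact absurd (csInf_le hBbdd hsB) (not_le.2 hs)
    -- far on the closed segment `[0, s₂]`
    have hfar₂ : ∀ s ∈ Icc 0 s₂, R₁ ≤ ‖Z s‖ := by
      intro s hs
      rcases hs.2.lt_or_eq with hl | he
      · exact hbefore s hs.1 hl
      · rw [he]
        rcases hs₂0.lt_or_eq with hpos | hzero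
        · have hCclosed : IsClosed {s | s ∈ Icc 0 S ∧ R₁ ≤ ‖Z s‖} := by
            have := hnc.preimage_isClosed_of_isClosed isClosed_Icc (isClosed_Ici (a := R₁))
            convert this using 1
            ext s; simp [Set.mem_preimage, and_comm]
          have hsub : Ico 0 s₂ ⊆ {s | s ∈ Icc 0 S ∧ R₁ ≤ ‖Z s‖} := fun s hs =>
            ⟨⟨hs.1, le_trans hs.2.le hs₂S⟩, hbefore s hs.1 hs.2⟩
          have hcl := hCclosed.closure_subset_iff.2 hsub
          have hmem : s₂ ∈ closure (Ico (0 : ℝ) s₂) := by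
            rw [closure_Ico hpos.ne]; exact right_mem_Icc.2 hs₂0
          exact (hcl hmem).2
        · rw [← hzero]; linarith
    -- so `‖Z s₂‖ ≥ 2R₁ > R₁`, and by continuity the arc stays beyond `R₁` a bit longer: contradiction with `s₂ = inf B`
    have hbig : 2 * R₁ ≤ ‖Z s₂‖ := by
      have h := hgron s₂ ⟨hs₂0, hs₂S⟩ hfar₂ s₂ (right_mem_Icc.2 hs₂0)
      have he : 1 ≤ Real.exp (c₁ * s₂) := Real.one_le_exp (by positivity)
      nlinarith [norm_nonneg (Z 0)]
    -- points of `B` accumulate at `s₂` from the right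
    have hcont₂ : ContinuousWithinAt (fun s => ‖Z s‖) (Icc 0 S) s₂ := hnc s₂ ⟨hs₂0, hs₂S⟩
    have hev : ∀ᶠ s in 𝓝[Icc 0 S] s₂, R₁ < ‖Z s‖ :=
      hcont₂.eventually (lt_mem_nhds (by linarith))
    obtain ⟨δ, hδ, hδball⟩ := Metric.eventually_nhds_iff.1 (eventually_nhdsWithin_iff.1 hev)
    have hlt₂ : s₂ < s₂ + δ := by linarith
    obtain ⟨s, hsB, hsδ⟩ := exists_lt_of_csInf_lt hBne (by rw [← hs₂def]; exact hlt₂)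
    have hs₂le : s₂ ≤ s := csInf_le hBbdd hsB
    have hdist : dist s s₂ < δ := by
      rw [Real.dist_eq, abs_lt]; constructor <;> linarith
    have := hδball hdist hsB.1
    exact absurd hsB.2 (not_lt.2 this.le)
  exact fun s hs => hgron S (right_mem_Icc.2 hS) hfarall s hs

end ChannelClock

end Summit.NavierStokesRegularity.NavierStokesRegularity.Theorems.PowerGaugeEulerLiouville

end
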